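import Summits.BirchSwinnertonDyer.BirchSwinnertonDyer.Theorems.KatoDescentPotSupersingularReducibleHullShaBound
import HarnessLib

/-!
# THE `λ`-EXACT `J`-ROAD FOR CRUX M (item 19196), TAME NORMAL FORM: with 27962's printed exponent of (b′) and `W(ℚ_p)[p] = 0`,
# `ord_p #Ш(W)[p^∞] + v_p(Tam W) ≤ ord_p(L(W,1)/Ω(W)) + 2·v_p #W(ℚ)_tors` AT `W` — `λ(0)`, `c_p` AND `t_p` all cancel (modulo {H2X, FW, Lim 3.5})

Seat `bsd-potss-rkm` g29 (prover, cell `bsd-potss`), item stmt-BirchSwinnertonDyer-19196 `ReducibleKatoMember` = crux M of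
K9 `KatoDescentPotSupersingular` (support) / K8-t′ `KatoDescentTamePotSupersingular` (auto-crux); `--supports … --as helper`;
route-free; closes nothing.  HONEST FRAMING: BSD is proved for no curve by this file; nothing is booked; crux M stays cite-level
on {modularity, HELD 27962 `Kato2004.exists_memberHullZetaCoreInputs`}; theorems only.

The prequels (`…ReducibleHullDescentCount`, `…ReducibleHullShaBound`) give, for any class `y ∈ 𝐇¹_Γ(T_pW)` with `y₀` of infinite order and
Kato's hull data `(F, j, z, λ)`, on a reducible row with `W(ℚ_p)[p] = 0`: `ord Ш[p^∞] + v Tam ≤ ord_p q + t_p + 2·v tors` when (b′) holds with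
27962's exponent `e = ord_p q + v_p(λ(0)) + t_p − v_p(c_p)` (`L(W,1)/Ω(W) = q`, `t_p = ord_p #W(ℚ_v)[p^∞]`).  THIS FILE discharges `t_p = 0`
on these rows (`ExactFineControl.natCard_primaryComponent_point_adicCompletion_eq_one_of_noPTorsionPadic`, seat g27): the bound becomes
**`ord_p #Ш(W)[p^∞] + v_p(Tam W) ≤ ord_p q + 2·v_p #W(ℚ)_tors`** — crux M's printed inequality AT `W` with slack `2` (M allows `3` and an
isogenous `W'`), for ANY class carrying the hull data; rows: every additive `p ≥ 11` (all (t′) rows of K8-t′), `p ∈ {5,7}` off Kodaira II/III.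

References: K. Kato, Astérisque 295 (2004), Thm. 12.5 (1)–(3), 12.6 (pp. 221–222), Lemma 13.10 (1) (p. 230), 13.14 (p. 234), Thm. 14.5 (p. 236),
Prop. 14.16 (2) (pp. 244–245), Lemma 14.18 (pp. 247–248) [Kato2004Asterisque]; C.-H. Kim, AJM 148 §3.2.3 [Kim2022StructureSelmer];
B. Mazur, Publ. IHÉS 47 (1977) III.§5 [Mazur1977].
-/

-- the summit and its single problem are both named `BirchSwinnertonDyer` (registry layout D-0017)
set_option linter.dupNamespace false
set_option autoImplicit false

noncomputable section

open scoped Classical NumberField TensorProduct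
open Function Field NumberField IsDedekindDomain WeierstrassCurve CongruenceSubgroup
open Literature.NumberTheory.EllipticCurves Literature.NumberTheory.EllipticCurves.GreenbergSelmer
open Literature.NumberTheory.GaloisRepresentations
open Literature.NumberTheory.EllipticCurves.ModularForms
open Literature.NumberTheory.EllipticCurves.Kato2004 Literature.NumberTheory.EllipticCurves.Kato2004.EulerSystemValues
open Literature.NumberTheory.EllipticCurves.IwasawaAlgebra Literature.NumberTheory.EllipticCurves.IwasawaDual
open Literature.NumberTheory.GaloisRepresentations.DiscreteGaloisModule Literature.NumberTheory.GaloisCohomology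
open Literature.NumberTheory.EllipticCurves.Rank1Residual
open Summit.BirchSwinnertonDyer.Rank1Residual
open Summit.BirchSwinnertonDyer.Rank1Residual.X11b.Levels Summit.BirchSwinnertonDyer.Rank1Residual.X11b.LocBridge
  Summit.BirchSwinnertonDyer.Rank1Residual.X11b.AcSelmer
open Summit.BirchSwinnertonDyer.BirchSwinnertonDyer.Theorems
open Summit.BirchSwinnertonDyer.BirchSwinnertonDyer.Theorems.ASideJunction
open Summit.BirchSwinnertonDyer.BirchSwinnertonDyer.Theorems.KatoFiniteLevelCount
open Summit.BirchSwinnertonDyer.BirchSwinnertonDyer.Theorems.StrictSelmerBridge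
open Summit.BirchSwinnertonDyer.BirchSwinnertonDyer.Theorems.IntegralH1LayerZeroTop

universe u

namespace Summit.BirchSwinnertonDyer.BirchSwinnertonDyer.Theorems.ReducibleHullDescentCount

section Tame

variable (W : WeierstrassCurve ℚ) [W.IsElliptic] (p : ℕ) [Fact p.Prime]
  [ContinuousSMul ℤ_[p] (W.tateModule p)]
  [Finite W.toAffine.Point] [Finite (AddCommGroup.primaryComponent W.sha p)]
  {κ : ZpExtension ℚ p} {γ : absoluteGaloisGroup ℚ}

/-- **CRUX M's INEQUALITY AT `W`, SLACK `2`, from the hull sub-package of 27962 + {H2X, FW, Lim 3.5}, on a reducible row with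
`W(ℚ_p)[p] = 0`.**  Data: `p ≠ 2`, `W[p]` reducible, `W(ℚ)`, `Ш(W)[p^∞]` finite, `(κ,γ)` cyclotomic, `I` the pin; ANY `y ∈ 𝐇¹_Γ(T_pW)` with `y₀`
of infinite order; hull data `(F, j, z, λ)` (`j y = λ·z`, Thm. 12.5 (3) for `z` against `X₀` off `(p)`); (b′) with 27962's printed exponent
`e = ord_p q + v_p(λ(0)) + t_p − v_p(c_p)`, `L(W,1)/Ω(W) = q`.  Conclusion: **`ord_p #Ш(W)[p^∞] + v_p(Tam W) ≤ ord_p q + 2·v_p #W(ℚ)_tors`**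
(`t_p = 0` since `W(ℚ_v)[p^∞] = 0`).  Modulo the three named facts in the binders; everything else kernel.
[cite: Kato2004Asterisque, Thm. 12.5 (1)–(3) (pp. 221–222), Lemma 13.10 (1) (p. 230), Prop. 14.16 (2) (pp. 244–245), Lemma 14.18 (pp. 247–248)]
[cite: Kim2022StructureSelmer, §3.2.3 display before Thm. 3.7 (PDF p. 16)] -/
theorem padicValNat_sha_add_tamagawa_le_two_mul_of_zetaLineOrthIndexAt_normalForm_of_hull
    (hX : exists_iwasawaH2Data_fineSelmerDual_embedding)
    (hLim : Lim2017.thm35_fineSelmerDual_moduleFinite_of_classicalMuVanishes_of_le_divisionField)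
    (hFW : Literature.NumberTheory.IwasawaTheory.ferreroWashington1979_classicalMuVanishes)
    (hp : p ≠ 2) (hκ : κ.IsCyclotomic) (hγ : κ.IsTopGenerator γ) (hred : ¬ W.HasIrreducibleModPGaloisRep p)
    (h4 : ∀ R : (W.baseChange ℚ_[p]).toAffine.Point, p • R = 0 → R = 0)
    (I : IwasawaH1Data W p κ γ)
    {F : Type} [AddCommGroup F] [Module (IwasawaAlgebra p) F] [Module.Finite (IwasawaAlgebra p) F]
    [NoZeroSMulDivisors (IwasawaAlgebra p) F]
    (j : I.H →ₗ[IwasawaAlgebra p] F) (hj : Function.Injective j) (hcok : Finite (F ⧸ LinearMap.range j))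
    (z : F) (hz : z ≠ 0) (hFZ : Module.IsTorsion (IwasawaAlgebra p) (F ⧸ (IwasawaAlgebra p) ∙ z))
    (hdiv : ∀ 𝔮 : PrimeSpectrum (IwasawaAlgebra p), 𝔮.asIdeal.height = 1 → 𝔮.asIdeal ≠ augIdealP p →
      Module.lengthAt (IwasawaAlgebra p) (W.fineSelmerDualData κ hγ).X 𝔮 ≤
        Module.lengthAt (IwasawaAlgebra p) (F ⧸ (IwasawaAlgebra p) ∙ z) 𝔮)
    (y : I.H) (lam : IwasawaAlgebra p) (hlam : PowerSeries.constantCoeff lam ≠ 0) (hjy : j y = lam • z)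
    (hnt : ¬ IsOfFinAddOrder (I.proj 0 y)) {q : ℚ} {e : ℕ}
    (he : (e : ℤ) = padicValRat p q + ((PowerSeries.constantCoeff lam).valuation : ℤ) +
        (padicValNat p (Nat.card (AddCommGroup.primaryComponent
          (W.baseChange ((primePlace p).adicCompletion ℚ)).toAffine.Point p)) : ℤ) -
        (padicValNat p ((W.baseChange ((primePlace p).adicCompletion ℚ)).localTamagawaNumber
          ((primePlace p).adicCompletionIntegers ℚ)) : ℤ))
    (hb : ZetaLineOrthIndexAt W p (layerZeroToTop W p κ (I.proj 0 y)) e) :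
    (padicValNat p (Nat.card (AddCommGroup.primaryComponent W.sha p)) : ℤ) + padicValNat p W.tamagawaProduct ≤
      padicValRat p q + 2 * (padicValNat p W.torsionOrder : ℤ) := by
  have h := padicValNat_sha_add_tamagawa_le_of_zetaLineOrthIndexAt_normalForm_of_hull W p hX hLim hFW hp hκ hγ hred h4 I j hj hcok z hz
    hFZ hdiv y lam hlam hjy hnt he hb
  rw [ExactFineControl.natCard_primaryComponent_point_adicCompletion_eq_one_of_noPTorsionPadic W h4, padicValNat_one_right,
    Nat.cast_zero, add_zero] at h
  exact h

/-- **The tame normal form on EVERY additive row at `p ≥ 11`** (all (t′) rows of K8-t′; `W(ℚ_p)[p] = 0` by Mazur's step).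
[cite: Kato2004Asterisque, Thm. 12.5 (3) (p. 222), Prop. 14.16 (2) (pp. 244–245)] [cite: Mazur1977, Ch. III §5, Step 1 (p. 158)] -/
theorem padicValNat_sha_add_tamagawa_le_two_mul_of_zetaLineOrthIndexAt_normalForm_of_hull_of_addv_of_eleven_le [W.IsGloballyMinimal]
    (hX : exists_iwasawaH2Data_fineSelmerDual_embedding)
    (hLim : Lim2017.thm35_fineSelmerDual_moduleFinite_of_classicalMuVanishes_of_le_divisionField)
    (hFW : Literature.NumberTheory.IwasawaTheory.ferreroWashington1979_classicalMuVanishes)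
    (h11 : 11 ≤ p) (hadd : Addv W p) (hκ : κ.IsCyclotomic) (hγ : κ.IsTopGenerator γ) (hred : ¬ W.HasIrreducibleModPGaloisRep p)
    (I : IwasawaH1Data W p κ γ)
    {F : Type} [AddCommGroup F] [Module (IwasawaAlgebra p) F] [Module.Finite (IwasawaAlgebra p) F]
    [NoZeroSMulDivisors (IwasawaAlgebra p) F]
    (j : I.H →ₗ[IwasawaAlgebra p] F) (hj : Function.Injective j) (hcok : Finite (F ⧸ LinearMap.range j))
    (z : F) (hz : z ≠ 0) (hFZ : Module.IsTorsion (IwasawaAlgebra p) (F ⧸ (IwasawaAlgebra p) ∙ z))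
    (hdiv : ∀ 𝔮 : PrimeSpectrum (IwasawaAlgebra p), 𝔮.asIdeal.height = 1 → 𝔮.asIdeal ≠ augIdealP p →
      Module.lengthAt (IwasawaAlgebra p) (W.fineSelmerDualData κ hγ).X 𝔮 ≤
        Module.lengthAt (IwasawaAlgebra p) (F ⧸ (IwasawaAlgebra p) ∙ z) 𝔮)
    (y : I.H) (lam : IwasawaAlgebra p) (hlam : PowerSeries.constantCoeff lam ≠ 0) (hjy : j y = lam • z)
    (hnt : ¬ IsOfFinAddOrder (I.proj 0 y)) {q : ℚ} {e : ℕ}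
    (he : (e : ℤ) = padicValRat p q + ((PowerSeries.constantCoeff lam).valuation : ℤ) +
        (padicValNat p (Nat.card (AddCommGroup.primaryComponent
          (W.baseChange ((primePlace p).adicCompletion ℚ)).toAffine.Point p)) : ℤ) -
        (padicValNat p ((W.baseChange ((primePlace p).adicCompletion ℚ)).localTamagawaNumber
          ((primePlace p).adicCompletionIntegers ℚ)) : ℤ))
    (hb : ZetaLineOrthIndexAt W p (layerZeroToTop W p κ (I.proj 0 y)) e) :
    (padicValNat p (Nat.card (AddCommGroup.primaryComponent W.sha p)) : ℤ) + padicValNat p W.tamagawaProduct ≤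
      padicValRat p q + 2 * (padicValNat p W.torsionOrder : ℤ) :=
  padicValNat_sha_add_tamagawa_le_two_mul_of_zetaLineOrthIndexAt_normalForm_of_hull W p hX hLim hFW (by omega) hκ hγ hred
    (fun _ hR ↦ Additive.eq_zero_of_prime_nsmul_eq_zero_of_addv_of_eleven_le W p h11 hadd hR) I j hj hcok z hz hFZ hdiv y lam hlam
    hjy hnt he hb

/-- **The tame normal form on an additive row at `p ≥ 5` off Kodaira II/III** (`p = 5 ⟹ v₅(c₄) ≠ 1`, `p = 7 ⟹ v₇(c₆) ≠ 1`).
[cite: Kato2004Asterisque, Thm. 12.5 (3) (p. 222), Prop. 14.16 (2) (pp. 244–245)] [cite: Mazur1977, Ch. III §5, Step 1 (p. 158)] -/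
theorem padicValNat_sha_add_tamagawa_le_two_mul_of_zetaLineOrthIndexAt_normalForm_of_hull_of_addv [W.IsGloballyMinimal]
    (hX : exists_iwasawaH2Data_fineSelmerDual_embedding)
    (hLim : Lim2017.thm35_fineSelmerDual_moduleFinite_of_classicalMuVanishes_of_le_divisionField)
    (hFW : Literature.NumberTheory.IwasawaTheory.ferreroWashington1979_classicalMuVanishes)
    (hp5 : 5 ≤ p) (hadd : Addv W p) (h5 : p = 5 → padicValRat p W.c₄ ≠ 1) (h7 : p = 7 → padicValRat p W.c₆ ≠ 1)
    (hκ : κ.IsCyclotomic) (hγ : κ.IsTopGenerator γ) (hred : ¬ W.HasIrreducibleModPGaloisRep p)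
    (I : IwasawaH1Data W p κ γ)
    {F : Type} [AddCommGroup F] [Module (IwasawaAlgebra p) F] [Module.Finite (IwasawaAlgebra p) F]
    [NoZeroSMulDivisors (IwasawaAlgebra p) F]
    (j : I.H →ₗ[IwasawaAlgebra p] F) (hj : Function.Injective j) (hcok : Finite (F ⧸ LinearMap.range j))
    (z : F) (hz : z ≠ 0) (hFZ : Module.IsTorsion (IwasawaAlgebra p) (F ⧸ (IwasawaAlgebra p) ∙ z))
    (hdiv : ∀ 𝔮 : PrimeSpectrum (IwasawaAlgebra p), 𝔮.asIdeal.height = 1 → 𝔮.asIdeal ≠ augIdealP p →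
      Module.lengthAt (IwasawaAlgebra p) (W.fineSelmerDualData κ hγ).X 𝔮 ≤
        Module.lengthAt (IwasawaAlgebra p) (F ⧸ (IwasawaAlgebra p) ∙ z) 𝔮)
    (y : I.H) (lam : IwasawaAlgebra p) (hlam : PowerSeries.constantCoeff lam ≠ 0) (hjy : j y = lam • z)
    (hnt : ¬ IsOfFinAddOrder (I.proj 0 y)) {q : ℚ} {e : ℕ}
    (he : (e : ℤ) = padicValRat p q + ((PowerSeries.constantCoeff lam).valuation : ℤ) +
        (padicValNat p (Nat.card (AddCommGroup.primaryComponent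
          (W.baseChange ((primePlace p).adicCompletion ℚ)).toAffine.Point p)) : ℤ) -
        (padicValNat p ((W.baseChange ((primePlace p).adicCompletion ℚ)).localTamagawaNumber
          ((primePlace p).adicCompletionIntegers ℚ)) : ℤ))
    (hb : ZetaLineOrthIndexAt W p (layerZeroToTop W p κ (I.proj 0 y)) e) :
    (padicValNat p (Nat.card (AddCommGroup.primaryComponent W.sha p)) : ℤ) + padicValNat p W.tamagawaProduct ≤
      padicValRat p q + 2 * (padicValNat p W.torsionOrder : ℤ) :=
  padicValNat_sha_add_tamagawa_le_two_mul_of_zetaLineOrthIndexAt_normalForm_of_hull W p hX hLim hFW (by omega) hκ hγ hred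
    (fun _ hR ↦ Additive.eq_zero_of_prime_nsmul_eq_zero_of_addv W p hp5 hadd h5 h7 hR) I j hj hcok z hz hFZ hdiv y lam hlam hjy hnt
    he hb

end Tame

end Summit.BirchSwinnertonDyer.BirchSwinnertonDyer.Theorems.ReducibleHullDescentCount

end
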